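import Literature.NumberTheory.Automorphic.HyperspecialUnitaryIwasawaTorus
import Literature.NumberTheory.Automorphic.SatakeTransformGL
import HarnessLib

/-!
# Iwasawa decomposition of the quasi-split unitary group — IV: the Iwasawa exponents `a(g)` of `g ∈ U(σ, J₀)`
# (Bruhat–Tits 1972 (4.4.3) (1); Cartier 1979 §IV (4.2))

Topic `NumberTheory/Automorphic`; namespace `Literature.NumberTheory.Automorphic.HermitianLattice.UnramifiedLocalConjDatum`
(lane `lit-hodgefound`, Track 2 foundations; seat `lit-hodgefound-p11`, generation 36, row g36-#5).  ONE DEFINITION with a body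
(`UnramifiedLocalConjDatum.iwasawaExp`, by `choose` on the torus normal form of `HyperspecialUnitaryIwasawaTorus`) + its API;
no named fact, no instance, no notation.  The unitary analogue of the tree's `iwasawaExp` for `GL_n` (`SatakeTransformGL`),
the coordinate on which a Satake transform of `ℋ(U(σ, J₀), K₀)` is built.

Setting: `K` a field with `Valued K ℤᵐ⁰`, `UnramifiedLocalConjDatum σ ϖ` (`σ` an involution preserving the valuation, `ϖ` a
`σ`-fixed uniformiser), `U(σ, J₀) = unitaryGroupOfForm σ (J₀.over K)`, `K₀ = unitaryInt σ (J₀.over K)`, `U` = upper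
unitriangular elements, torus representatives `diag(ϖ^{a_i})` (`zpowDiagGL`) with `a ∘ rev = -a`.

## The print

[BruhatTits1972] Prop. (4.4.3) (1): «`G = B̂⁰.V.K` … et l'application canonique de `V` dans `B̂⁰\G/K` est bijective» — so
every `g` has a well-defined `V`-coordinate.  [CartierCorvallis1979] §IV (4.2): the Satake transform
`Sf(m) = δ(m)^{1/2} ∫_N f(nm) dn` is computed on the torus part `m` of `g = n m k`; for its discrete form one needs the
exponent function `g ↦ a(g)` on `G/K`, invariant under `N` on the left and additive under the torus (proof of Thm. 4.1,
step (a)).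

## What is formalised

* `exists_iwasawaExp`, **`iwasawaExp hd g : Fin N → ℤ`**, `iwasawaExp_spec` (`g = u · diag(ϖ^{a(g)}) · k`), `iwasawaExp_rev`
  (`a(g) ∘ rev = -a(g)`), **`iwasawaExp_eq`** (any normal form computes it).
* Invariance and additivity: `iwasawaExp_mul_of_mem_unitaryInt` (`a(gk) = a(g)`), `iwasawaExp_eq_of_coe_eq` ∕ `iwasawaExp_out_coe` (a
  function on `U(σ, J₀) / K₀`), `iwasawaExp_unipotent_mul` (`a(ug) = a(g)`), **`iwasawaExp_zpowDiagGL_mul`** (`a(diag(ϖ^b) g) = b + a(g)`),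
  `iwasawaExp_zpowDiagGL`, `iwasawaExp_one`, `iwasawaExp_of_mem_unitaryInt`, `iwasawaExp_of_mem_upperUnitriangular`.
* `v_apply_self_eq_exp_neg_iwasawaExp` — for an upper triangular `b ∈ U(σ, J₀)`, `v(b_{ii}) = exp(-a(b)_i)`.

## References
* [BruhatTits1972] F. Bruhat, J. Tits, *Groupes réductifs sur un corps local I*, Publ. Math. IHÉS 41 (1972), (4.4.3).
* [CartierCorvallis1979] P. Cartier, *Representations of 𝔭-adic groups: a survey*, PSPM 33.1 (1979), §IV (4.2), Thm. 4.1.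
* [Tits1979] J. Tits, *Reductive groups over local fields*, Proc. Symp. Pure Math. 33.1 (1979), §3.3.2.
-/

noncomputable section

open scoped Valued WithZero Matrix MatrixGroups

namespace Literature.NumberTheory.Automorphic.HermitianLattice

open Literature.NumberTheory.Automorphic.CartanUnique Literature.NumberTheory.Automorphic.SymplecticCartan

variable {K : Type*} [Field K] [Valued K ℤᵐ⁰] {σ : K →+* K} {ϖ : K} {N : ℕ}

namespace UnramifiedLocalConjDatum

/-- The Iwasawa decomposition with the exponents quantified first. [cite: BruhatTits1972, (4.4.3)] -/
theorem exists_iwasawaExp (hd : UnramifiedLocalConjDatum σ ϖ) (g : unitaryGroupOfForm σ ((StdForm.antidiagonal N).over K)) :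
    ∃ a : Fin N → ℤ, (∀ i, a (Fin.rev i) = -a i) ∧
      ∃ u t k : unitaryGroupOfForm σ ((StdForm.antidiagonal N).over K),
        (u : GL (Fin N) K) ∈ upperUnitriangular (Fin N) K ∧ (t : GL (Fin N) K) = zpowDiagGL (uniformizer_ne_zero hd.vϖ) a ∧
          k ∈ unitaryInt σ ((StdForm.antidiagonal N).over K) ∧ g = u * t * k := by
  obtain ⟨u, t, k, a, hu, ha, ht, hk, hg⟩ := hd.exists_eq_unipotent_mul_zpowDiagGL_mul_unitaryInt g
  exact ⟨a, ha, u, t, k, hu, ht, hk, hg⟩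

/-- **The Iwasawa exponents `a(g)` of `g ∈ U(σ, J₀)`**: the unique `a : Fin N → ℤ` (with `a ∘ rev = -a`) such that
`g ∈ U · diag(ϖ^{a_i}) · K₀`, `U` the upper unitriangular elements, `K₀ = U(σ, J₀) ∩ GL_N(𝒪)` — the `V`-coordinate of the
double coset `B̂⁰ g K` of [BruhatTits1972] (4.4.3) (1), the `H(m) = log` of the torus part `m` of `g = n m k` on which the
Satake transform `Sf(m) = δ(m)^{1/2} ∫_N f(nm) dn` is evaluated ([CartierCorvallis1979] §IV (4.2)); for `GL_n` the tree's
`iwasawaExp`. [cite: BruhatTits1972, (4.4.3)] [cite: CartierCorvallis1979, §IV (4.2)] -/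
def iwasawaExp (hd : UnramifiedLocalConjDatum σ ϖ) (g : unitaryGroupOfForm σ ((StdForm.antidiagonal N).over K)) :
    Fin N → ℤ :=
  (hd.exists_iwasawaExp g).choose

/-- The defining property of `iwasawaExp`: `g = u · diag(ϖ^{a(g)}) · k`. [cite: BruhatTits1972, (4.4.3)] -/
theorem iwasawaExp_spec (hd : UnramifiedLocalConjDatum σ ϖ) (g : unitaryGroupOfForm σ ((StdForm.antidiagonal N).over K)) :
    ∃ u t k : unitaryGroupOfForm σ ((StdForm.antidiagonal N).over K),
      (u : GL (Fin N) K) ∈ upperUnitriangular (Fin N) K ∧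
        (t : GL (Fin N) K) = zpowDiagGL (uniformizer_ne_zero hd.vϖ) (hd.iwasawaExp g) ∧
          k ∈ unitaryInt σ ((StdForm.antidiagonal N).over K) ∧ g = u * t * k :=
  (hd.exists_iwasawaExp g).choose_spec.2

/-- The Iwasawa exponents form a cocharacter of the maximal split torus: `a(g) (rev i) = -a(g) i`.
[cite: BruhatTits1972, (4.4.3)] -/
theorem iwasawaExp_rev (hd : UnramifiedLocalConjDatum σ ϖ) (g : unitaryGroupOfForm σ ((StdForm.antidiagonal N).over K))
    (i : Fin N) : hd.iwasawaExp g (Fin.rev i) = -hd.iwasawaExp g i :=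
  (hd.exists_iwasawaExp g).choose_spec.1 i

/-- **Uniqueness**: any decomposition `g = u · diag(ϖ^a) · k` computes `iwasawaExp`. [cite: BruhatTits1972, (4.4.3)] -/
theorem iwasawaExp_eq (hd : UnramifiedLocalConjDatum σ ϖ) {g u t k : unitaryGroupOfForm σ ((StdForm.antidiagonal N).over K)}
    {a : Fin N → ℤ} (hu : (u : GL (Fin N) K) ∈ upperUnitriangular (Fin N) K)
    (ht : (t : GL (Fin N) K) = zpowDiagGL (uniformizer_ne_zero hd.vϖ) a)
    (hk : k ∈ unitaryInt σ ((StdForm.antidiagonal N).over K)) (h : g = u * t * k) : hd.iwasawaExp g = a := by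
  obtain ⟨u', t', k', hu', ht', hk', h'⟩ := hd.iwasawaExp_spec g
  exact hd.iwasawa_exponents_unique hu' hu ht' ht hk' hk h' h

/-- `a(g k) = a(g)` for `k ∈ K₀`: the exponents are a function on `U(σ, J₀) / K₀`. [cite: BruhatTits1972, (4.4.3)] -/
theorem iwasawaExp_mul_of_mem_unitaryInt (hd : UnramifiedLocalConjDatum σ ϖ)
    (g : unitaryGroupOfForm σ ((StdForm.antidiagonal N).over K)) {k : unitaryGroupOfForm σ ((StdForm.antidiagonal N).over K)}
    (hk : k ∈ unitaryInt σ ((StdForm.antidiagonal N).over K)) : hd.iwasawaExp (g * k) = hd.iwasawaExp g := by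
  obtain ⟨u, t, k', hu, ht, hk', h⟩ := hd.iwasawaExp_spec g
  refine hd.iwasawaExp_eq hu ht ((unitaryInt σ _).mul_mem hk' hk) ?_
  rw [h, mul_assoc]

/-- Equal cosets in `U(σ, J₀) / K₀` have equal exponents. [cite: BruhatTits1972, (4.4.3)] -/
theorem iwasawaExp_eq_of_coe_eq (hd : UnramifiedLocalConjDatum σ ϖ) {g g' : unitaryGroupOfForm σ ((StdForm.antidiagonal N).over K)}
    (h : (g : unitaryGroupOfForm σ ((StdForm.antidiagonal N).over K) ⧸ unitaryInt σ ((StdForm.antidiagonal N).over K)) = g') :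
    hd.iwasawaExp g = hd.iwasawaExp g' := by
  rw [QuotientGroup.eq] at h
  have : g' = g * (g⁻¹ * g') := by rw [mul_inv_cancel_left]
  rw [this, hd.iwasawaExp_mul_of_mem_unitaryInt g h]

/-- `a((gK₀).out) = a(g)`: the exponents of the chosen representative of a coset. [cite: BruhatTits1972, (4.4.3)] -/
theorem iwasawaExp_out_coe (hd : UnramifiedLocalConjDatum σ ϖ) (g : unitaryGroupOfForm σ ((StdForm.antidiagonal N).over K)) :
    hd.iwasawaExp ((g : unitaryGroupOfForm σ ((StdForm.antidiagonal N).over K) ⧸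
      unitaryInt σ ((StdForm.antidiagonal N).over K)).out) = hd.iwasawaExp g :=
  hd.iwasawaExp_eq_of_coe_eq (QuotientGroup.out_eq' _)

/-- `a(u g) = a(g)` for `u` upper unitriangular: the exponents are `U`-invariant on the left. [cite: BruhatTits1972, (4.4.3)] -/
theorem iwasawaExp_unipotent_mul (hd : UnramifiedLocalConjDatum σ ϖ) {u : unitaryGroupOfForm σ ((StdForm.antidiagonal N).over K)}
    (hu : (u : GL (Fin N) K) ∈ upperUnitriangular (Fin N) K) (g : unitaryGroupOfForm σ ((StdForm.antidiagonal N).over K)) :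
    hd.iwasawaExp (u * g) = hd.iwasawaExp g := by
  obtain ⟨u', t, k, hu', ht, hk, h⟩ := hd.iwasawaExp_spec g
  refine hd.iwasawaExp_eq (u := u * u') (by rw [Subgroup.coe_mul]; exact (upperUnitriangular (Fin N) K).mul_mem hu hu')
    ht hk ?_
  rw [h, mul_assoc, mul_assoc, mul_assoc]

/-- **Additivity along the torus**: `a(diag(ϖ^b) · g) = b + a(g)` for a cocharacter `b` (`b ∘ rev = -b`): conjugating the
unipotent part by the torus keeps it in `U` (Cartier's step (a) in the proof that the Satake transform is multiplicative).
[cite: BruhatTits1972, (4.4.3)] [cite: CartierCorvallis1979, §IV Thm. 4.1] -/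
theorem iwasawaExp_zpowDiagGL_mul (hd : UnramifiedLocalConjDatum σ ϖ) {b : Fin N → ℤ} (hb : ∀ i, b (Fin.rev i) = -b i)
    (g : unitaryGroupOfForm σ ((StdForm.antidiagonal N).over K)) :
    hd.iwasawaExp ((⟨zpowDiagGL (uniformizer_ne_zero hd.vϖ) b, zpowDiagGL_mem_unitaryGroupOfForm hd.σϖ _ hb⟩ :
      unitaryGroupOfForm σ ((StdForm.antidiagonal N).over K)) * g) = b + hd.iwasawaExp g := by
  have hϖ0 := uniformizer_ne_zero hd.vϖ
  obtain ⟨u, t, k, hu, ht, hk, h⟩ := hd.iwasawaExp_spec g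
  set Z : unitaryGroupOfForm σ ((StdForm.antidiagonal N).over K) :=
    ⟨zpowDiagGL hϖ0 b, zpowDiagGL_mem_unitaryGroupOfForm hd.σϖ _ hb⟩ with hZ
  -- `Z u Z⁻¹` is upper unitriangular and `Z t = diag(ϖ^{b + a})`
  have hconj : ((Z * u * Z⁻¹ : unitaryGroupOfForm σ ((StdForm.antidiagonal N).over K)) : GL (Fin N) K) ∈
      upperUnitriangular (Fin N) K := by
    rw [Subgroup.coe_mul, Subgroup.coe_mul, Subgroup.coe_inv]
    exact zpowDiagGL_mul_mul_inv_mem_upperUnitriangular hϖ0 b hu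
  have hZt : ((Z * t : unitaryGroupOfForm σ ((StdForm.antidiagonal N).over K)) : GL (Fin N) K) =
      zpowDiagGL hϖ0 (b + hd.iwasawaExp g) := by
    rw [Subgroup.coe_mul, ht, zpowDiagGL_add]
  refine hd.iwasawaExp_eq hconj hZt hk ?_
  rw [h]
  group

/-- `a(diag(ϖ^b)) = b`. [cite: BruhatTits1972, (4.4.3)] -/
theorem iwasawaExp_zpowDiagGL (hd : UnramifiedLocalConjDatum σ ϖ) {b : Fin N → ℤ} (hb : ∀ i, b (Fin.rev i) = -b i) :
    hd.iwasawaExp (⟨zpowDiagGL (uniformizer_ne_zero hd.vϖ) b, zpowDiagGL_mem_unitaryGroupOfForm hd.σϖ _ hb⟩ :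
      unitaryGroupOfForm σ ((StdForm.antidiagonal N).over K)) = b :=
  hd.iwasawaExp_eq (u := 1) (k := 1) (Subgroup.one_mem _) rfl (Subgroup.one_mem _) (by rw [one_mul, mul_one])

/-- `a(1) = 0`. [cite: BruhatTits1972, (4.4.3)] -/
theorem iwasawaExp_one (hd : UnramifiedLocalConjDatum σ ϖ) :
    hd.iwasawaExp (1 : unitaryGroupOfForm σ ((StdForm.antidiagonal N).over K)) = 0 :=
  hd.iwasawaExp_eq (u := 1) (t := 1) (k := 1) (a := 0) (Subgroup.one_mem _)
    (by rw [zpowDiagGL_zero]; rfl) (Subgroup.one_mem _) (by rw [mul_one, mul_one])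

/-- `a(k) = 0` for `k ∈ K₀`. [cite: BruhatTits1972, (4.4.3)] -/
theorem iwasawaExp_of_mem_unitaryInt (hd : UnramifiedLocalConjDatum σ ϖ)
    {k : unitaryGroupOfForm σ ((StdForm.antidiagonal N).over K)} (hk : k ∈ unitaryInt σ ((StdForm.antidiagonal N).over K)) :
    hd.iwasawaExp k = 0 := by
  rw [← one_mul k, hd.iwasawaExp_mul_of_mem_unitaryInt 1 hk, hd.iwasawaExp_one]

/-- `a(u) = 0` for `u` upper unitriangular. [cite: BruhatTits1972, (4.4.3)] -/
theorem iwasawaExp_of_mem_upperUnitriangular (hd : UnramifiedLocalConjDatum σ ϖ)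
    {u : unitaryGroupOfForm σ ((StdForm.antidiagonal N).over K)} (hu : (u : GL (Fin N) K) ∈ upperUnitriangular (Fin N) K) :
    hd.iwasawaExp u = 0 := by
  rw [← mul_one u, hd.iwasawaExp_unipotent_mul hu, hd.iwasawaExp_one]

/-- **The exponents of an upper triangular `b ∈ U(σ, J₀)` are the valuations of its diagonal**: `v(b_{ii}) = exp(-a(b)_i)`
(`b = u · diag(b_{ii})`, `diag(b_{ii}) = diag(ϖ^{a}) · diag(units)`). [cite: BruhatTits1972, (4.4.3)] [cite: CartierCorvallis1979, §IV (4.2)] -/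
theorem v_apply_self_eq_exp_neg_iwasawaExp (hd : UnramifiedLocalConjDatum σ ϖ)
    {b : unitaryGroupOfForm σ ((StdForm.antidiagonal N).over K)}
    (hb : ((b : GL (Fin N) K) : Matrix (Fin N) (Fin N) K).BlockTriangular id) (i : Fin N) :
    Valued.v (((b : GL (Fin N) K) : Matrix (Fin N) (Fin N) K) i i) = WithZero.exp (-hd.iwasawaExp b i) := by
  have hϖ := hd.vϖ
  obtain ⟨u, t, k, hu, ht, hk, h⟩ := hd.iwasawaExp_spec b
  -- compare the two upper-triangular-times-`K₀` decompositions `b · 1 = (u t) · k`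
  have hut : (((u * t : unitaryGroupOfForm σ ((StdForm.antidiagonal N).over K)) : GL (Fin N) K) :
      Matrix (Fin N) (Fin N) K).BlockTriangular id := by
    rw [Subgroup.coe_mul, ht]; exact blockTriangular_mul_zpowDiagGL hu (uniformizer_ne_zero hϖ) _
  have h1 := v_apply_self_eq_of_upper_mul_unitaryInt_eq hb hut (Subgroup.one_mem _) hk (by rw [mul_one]; exact h) i
  rw [h1, Subgroup.coe_mul, ht, mul_zpowDiagGL_apply_self hu, v_uniformizer_zpow hϖ]

end UnramifiedLocalConjDatum

end Literature.NumberTheory.Automorphic.HermitianLattice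

end
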